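import Literature.Geometry.Kaehler.ComplexTorusWeilEigen
import Literature.Geometry.Kaehler.ComplexTorusWeilNeronSeveri
import Literature.Geometry.Kaehler.ComplexTorusHodgeClassesMaps
import Literature.Geometry.Kaehler.ComplexTorusDivisorClasses
import Literature.Geometry.Kaehler.ComplexTorusHodgeClassesDimension
import HarnessLib

/-!
# Exceptional Hodge classes on the explicit complex torus of Weil type: `H⁴_Hodge(X) ≠ 0 = D²(X)`

Layer `Literature/Geometry/Kaehler`; lane `lit-hodgefound`, Layer A4 (row A4-25 of
`run/shared/lean/pub/lit-hodgefound/SKELETON.md`: the Weil classes, A4-10, at the concrete torus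
level). For the EXPLICIT complex torus of Weil type `X = ℂ⁴/Φ(ℤ⁸)`, `Φ = Weil.periodEquiv`
(`ComplexTorusWeilPeriod.lean`: transcendental period, lattice stable under `J = diag(i, i, -i, -i)`),
we PROVE, in the lane's concrete carriers `ComplexTorus.hodgeClasses Φ p = H^{2p}(X, ℚ) ∩ H^{p,p}`
and `ComplexTorus.divisorClasses Φ p = Dᵖ(X)` (`ComplexTorusHodgeClasses.lean`,
`ComplexTorusDivisorClasses.lean`):

* `Weil.hodgeClasses_one_eq_bot` — `H²_Hodge(X) = 0` (`NS(X) ⊗ ℚ = 0`; the transcendence computation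
  `Weil.eq_zero_of_mem_span_coordForm_of_smul_I` of `ComplexTorusWeilNeronSeveri.lean`, Voisin 2002
  Prop. 3 (i) "for a general `X` as above, `NS(X) = 0`"), hence `Weil.divisorClasses_two_eq_bot`:
  `D²(X) = 0`;
* `Weil.exists_mem_hodgeClasses_two_ne_zero` — **`H⁴_Hodge(X) ≠ 0`**: there is a non-zero RATIONAL
  class of type `(2,2)` (a Weil class: a `-4`-eigenclass of the isogeny `(1 + I)^*`, Voisin 2002 §3
  "`⋀⁴_K Γ_ℚ` is made of Hodge classes"; Lange 2023, §7.2.4 Exercises (9)–(10) / §7.3.3 Exercise (9):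
  abelian varieties of Weil type carry Hodge classes outside `D•`);
* **`Weil.hodgeClasses_two_ne_divisorClasses_two`** — so `H⁴_Hodge(X) ≠ D²(X)`: the Hodge classes of
  this torus are NOT generated by divisor classes — a concrete, model-free instance showing that the
  criterion `Dᵖ = H^{2p}_Hodge` of Lange 2023, §7.3.1 (rows A4-15/A4-24) can fail, i.e. that
  `hodgeClasses` is genuinely larger than `divisorClasses` in general (Mumford–Weil; for this
  non-algebraic `X` these classes are Zucker/Voisin's Hodge classes not coming from subvarieties, the
  barrier `Voisin2002_weilTorus_hodgeClassWithoutSubvarieties`).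

## The Weil–Hodge plane (row A4-35, appended 2026-08-21 by skel-4 gen 3)

* `Weil.OmegaBar` (`Ω̄ = conj ∘ Ω`, `T Ω̄ = -4 Ω̄`), `Weil.weilEigenspace = ker(T + 4)` with
  `weilEigenspace_le_span : ker(T + 4) ≤ span_ℂ(Ω, Ω̄)` and `linearIndependent_Omega_OmegaBar`;
* **`Weil.weilHodgeClasses`** — the Weil–Hodge classes: rational classes in `ker(T + 4)`, i.e. the
  rational points of `⋀⁴ V_i^* ⊕ ⋀⁴ V_{-i}^*` (Lange 2023, §7.2.4 Exercise (9): "the cycles in the image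
  of `⋀^{2n}_K H¹(X, ℚ) ↪ H^{2n}_Hodge(X)` are called Weil–Hodge cycles"; Voisin 2002 §3 "`⋀⁴_K Γ_ℚ`"),
  `weilHodgeClasses_le_hodgeClasses` (they ARE Hodge classes), `span_complex_weilHodgeClasses`
  (`span_ℂ = span(Ω, Ω̄)`), **`finrank_weilHodgeClasses : dim_ℚ = 2`** (Exercise (10): the Weil–Hodge
  cycles form a `ℚ`-plane complementary to `D^n`), `two_le_finrank_hodgeClasses_two`,
  `weilHodgeClasses_inf_divisorClasses_eq_bot`.

## Proof of the existence (no de Rham comparison, no singular cohomology)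

Let `T γ = γ ∘ S`, `S = 1 + J` (`Weil.S`), a `ℂ`-linear operator on `Alt⁴_ℝ(ℂ⁴; ℂ) = H⁴(X, ℂ)`
preserving the rational forms `H⁴(X, ℚ)` (`S` is the analytic representation of the integer matrix
`1 + rotMatrix`, `realRep_one_add_rotMatrix`; tree `comp_realRep_mem_rationalForms`). By
`Weil.compContinuousLinearMap_S_four`, `T⁴ = 256`, so `Q = (T - 4)(T² + 16)` maps into the
`-4`-eigenspace of `T`, which consists of forms of type `(2,2)`
(`Weil.isConstOfType_two_two_of_compContinuousLinearMap_S`). Since `Q Ω = -256 Ω ≠ 0`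
(`Ω = dz₀ ∧ dz₁ ∧ dz̄₂ ∧ dz̄₃`, `Weil.Omega_compContinuousLinearMap_S`, `Weil.Omega_ne_zero`) and the
rational forms span `Alt⁴` over `ℂ` (`span_complex_rationalForms_eq_top`, row A4-22), `Q γ₀ ≠ 0` for
some rational `γ₀`, and `Q γ₀` is the required non-zero rational `(2,2)`-class.

## References

* [Voisin2002KaehlerCounterexample] C. Voisin, *A counterexample to the Hodge conjecture extended to
  Kähler varieties*, IMRN 2002 no. 20, §3, Prop. 3.
* [Lange2023AbelianVarietiesComplex] H. Lange, *Abelian Varieties over the Complex Numbers* (2023),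
  §7.2.4 Exercises (9)–(11), §7.3.1, §7.3.3 Exercise (9).
* [Zucker1977] S. Zucker, *The Hodge conjecture for cubic fourfolds*, Compositio Math. 34 (1977),
  Appendix B.
-/

noncomputable section

open scoped ComplexConjugate
open Set Function Complex Finset Module

namespace Literature.Geometry.Kaehler

namespace ComplexTorus

variable {ι : Type*} {E : Type*} [NormedAddCommGroup E] [NormedSpace ℂ E] (Φ : (ι → ℝ) ≃L[ℝ] E)

/-- A rational `2`-form is a rational combination of the coordinate forms `ε_{ab}`, `a < b` (its
coordinates in the basis `coordFormBasis` are its values on the lattice basis pairs, Prop. 1.1.20).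
[cite: Lange2023AbelianVarietiesComplex, §1.1.4 Prop. 1.1.20] -/
theorem mem_span_coordForm_of_mem_rationalForms [Fintype ι] [LinearOrder ι]
    {γ : E [⋀^Fin 2]→L[ℝ] ℂ} (hγ : γ ∈ rationalForms Φ 2) :
    γ ∈ Submodule.span ℚ (Set.range fun p : Pairs ι ↦ coordForm Φ p.1.1 p.1.2) := by
  classical
  have hq : ∀ p : Pairs ι, ∃ q : ℚ, (coordFormBasis Φ).repr γ p = q := fun p ↦ by
    obtain ⟨q, hq⟩ := hγ ![Pi.single p.1.1 1, Pi.single p.1.2 1]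
    refine ⟨q, ?_⟩
    rw [coordFormBasis_repr, ← hq]
    congr 1
    funext i
    fin_cases i <;> simp [latticeTuple_apply, latticeVec_single]
  choose q hq using hq
  rw [← (coordFormBasis Φ).sum_repr γ]
  refine Submodule.sum_mem _ fun p _ ↦ ?_
  rw [hq p, coordFormBasis_apply, Rat.cast_smul_eq_qsmul ℂ (q p)]
  exact Submodule.smul_mem _ _ (Submodule.subset_span ⟨p, rfl⟩)

/-- Type `(1,1)` gives `i`-invariance: `γ(iu, iv) = γ(u, v)` (the case `θ = π/2` of the weight
condition; private copy of the lemma of `ComplexTorusHodgeClassesEllipticSquare.lean`). [folklore] -/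
private theorem isOfTypeAt_one_one_apply_I_smul {γ : E [⋀^Fin 2]→L[ℝ] ℂ}
    (h : Literature.Analysis.Complex.IsOfTypeAt 1 1 γ) (u v : E) : γ ![I • u, I • v] = γ ![u, v] := by
  have hI : cexp (((Real.pi / 2 : ℝ) : ℂ) * I) = I := by
    rw [Complex.exp_mul_I, ← Complex.ofReal_cos, ← Complex.ofReal_sin, Real.cos_pi_div_two,
      Real.sin_pi_div_two]
    simp
  have h2 := h.2 (Real.pi / 2) ![u, v]
  have hexp : cexp ((((1 : ℕ) : ℤ) - (1 : ℕ) : ℤ) * ((Real.pi / 2 : ℝ) : ℂ) * I) = 1 := by simp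
  rw [hexp, one_mul, hI] at h2
  have e : (fun i ↦ I • (![u, v] : Fin 2 → E) i) = ![I • u, I • v] := by
    funext i; fin_cases i <;> rfl
  rw [e] at h2
  exact h2

end ComplexTorus

namespace Weil

open ComplexTorus

/-! ### `NS(X) ⊗ ℚ = 0` and `D²(X) = 0` for the explicit Weil torus -/

/-- **`H²_Hodge(X) = 0` for the explicit complex torus of Weil type** `X = ℂ⁴/Φ(ℤ⁸)`,
`Φ = Weil.periodEquiv`: a rational class of type `(1,1)` vanishes (`NS(X) ⊗ ℚ = 0`; Voisin 2002,
Prop. 3 (i), proved for the explicit period by transcendence in `ComplexTorusWeilNeronSeveri.lean`).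
[cite: Voisin2002KaehlerCounterexample, §3 Prop. 3] -/
theorem hodgeClasses_one_eq_bot : hodgeClasses periodEquiv 1 = ⊥ := by
  refine (Submodule.eq_bot_iff _).2 fun γ hγ ↦ ?_
  obtain ⟨hrat, htype⟩ := (mem_hodgeClasses_iff periodEquiv).1 hγ
  exact eq_zero_of_mem_span_coordForm_of_smul_I γ
    (mem_span_coordForm_of_mem_rationalForms periodEquiv hrat)
    (isOfTypeAt_one_one_apply_I_smul htype)

/-- `NS(X) = 0` for the explicit Weil torus: every `E ∈ NS(X)` vanishes.
[cite: Voisin2002KaehlerCounterexample, §3 Prop. 3] -/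
theorem eq_zero_of_isNSForm {η : (Fin 4 → ℂ) [⋀^Fin 2]→L[ℝ] ℝ} (hη : IsNSForm periodEquiv η) :
    η = 0 := by
  have h : ofRealForm η ∈ hodgeClasses periodEquiv 1 := ofRealForm_mem_hodgeClasses_one periodEquiv hη
  rw [hodgeClasses_one_eq_bot, Submodule.mem_bot] at h
  exact ofRealForm_injective (by rw [h]; ext v; simp)

/-- **`D²(X) = 0`**: with `NS(X) = 0` there are no products of divisor classes.
[cite: Lange2023AbelianVarietiesComplex, §7.3.1] -/
theorem divisorClasses_two_eq_bot : divisorClasses periodEquiv 2 = ⊥ := by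
  rw [divisorClasses, Submodule.span_eq_bot]
  rintro _ ⟨η, rfl⟩
  have h0 : ofRealForm ((η (Fin.last 1) : neronSeveriGroup periodEquiv) :
      (Fin 4 → ℂ) [⋀^Fin 2]→L[ℝ] ℝ) = 0 := by
    rw [eq_zero_of_isNSForm (η (Fin.last 1)).2]; ext v; simp
  show wedgeFamily (1 + 1) (fun i ↦ ofRealForm ((η i : neronSeveriGroup periodEquiv) :
      (Fin 4 → ℂ) [⋀^Fin 2]→L[ℝ] ℝ)) = 0
  rw [wedgeFamily_succ, h0, ContinuousAlternatingMap.wedge_zero]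

/-! ### The isogeny `1 + I` acts on `H⁴(X, ℚ)`; the Weil classes -/

/-- The analytic representation of the integer matrix `1 + rotMatrix` (the endomorphism `1 + I` of
`X`) is `S = 1 + J`. [cite: Voisin2002KaehlerCounterexample, §3 pp. 5–6] -/
theorem realRep_one_add_rotMatrix :
    realRep periodEquiv periodEquiv (1 + rotMatrix) = S.restrictScalars ℝ := by
  have h1 : ((1 + rotMatrix : Matrix (Fin 8) (Fin 8) ℤ).map (Int.cast : ℤ → ℝ)) =
      1 + rotMatrix.map (Int.cast : ℤ → ℝ) := by
    have h := map_add (Int.castRingHom ℝ).mapMatrix 1 rotMatrix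
    rw [map_one] at h
    simpa [RingHom.mapMatrix_apply] using h
  ext x : 1
  rw [realRep, ContinuousLinearMap.comp_apply, ContinuousLinearMap.comp_apply,
    ContinuousLinearMap.coe_restrictScalars', S_apply']
  simp only [ContinuousLinearEquiv.coe_coe, LinearMap.coe_toContinuousLinearMap',
    Matrix.mulVecLin_apply]
  rw [h1, Matrix.add_mulVec, Matrix.one_mulVec, map_add, ContinuousLinearEquiv.apply_symm_apply,
    periodEquiv_rotMatrix, ContinuousLinearEquiv.apply_symm_apply]

/-- `T = (1 + I)^* : γ ↦ γ ∘ S` preserves `H⁴(X, ℚ)` (pull-back along an endomorphism of `X`).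
[cite: Voisin2002KaehlerCounterexample, §3 pp. 5–6] -/
theorem compContinuousLinearMap_S_mem_rationalForms {k : ℕ} {γ : (Fin 4 → ℂ) [⋀^Fin k]→L[ℝ] ℂ}
    (hγ : γ ∈ rationalForms periodEquiv k) :
    γ.compContinuousLinearMap (S.restrictScalars ℝ) ∈ rationalForms periodEquiv k := by
  rw [← realRep_one_add_rotMatrix]
  exact comp_realRep_mem_rationalForms periodEquiv periodEquiv (1 + rotMatrix) hγ

/-- `T = (1 + J)^*` as a `ℂ`-linear operator on `Alt⁴_ℝ(ℂ⁴; ℂ) = H⁴(X, ℂ)`. Private plumbing.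
[folklore] -/
private def opT : ((Fin 4 → ℂ) [⋀^Fin 4]→L[ℝ] ℂ) →ₗ[ℂ] ((Fin 4 → ℂ) [⋀^Fin 4]→L[ℝ] ℂ) where
  toFun γ := γ.compContinuousLinearMap (S.restrictScalars ℝ)
  map_add' γ δ := by ext v; simp [ContinuousAlternatingMap.compContinuousLinearMap_apply]
  map_smul' c γ := by ext v; simp [ContinuousAlternatingMap.compContinuousLinearMap_apply]

/-- Unfolding of `opT`. [folklore] -/
private theorem opT_apply (γ : (Fin 4 → ℂ) [⋀^Fin 4]→L[ℝ] ℂ) :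
    opT γ = γ.compContinuousLinearMap (S.restrictScalars ℝ) := rfl

/-- `Q = (T - 4)(T² + 16) = T³ - 4T² + 16T - 64`. Private plumbing. [folklore] -/
private def opQ : ((Fin 4 → ℂ) [⋀^Fin 4]→L[ℝ] ℂ) →ₗ[ℂ] ((Fin 4 → ℂ) [⋀^Fin 4]→L[ℝ] ℂ) :=
  opT ∘ₗ opT ∘ₗ opT - (4 : ℂ) • (opT ∘ₗ opT) + (16 : ℂ) • opT - (64 : ℂ) • LinearMap.id

/-- Unfolding of `opQ`. [folklore] -/
private theorem opQ_apply (γ : (Fin 4 → ℂ) [⋀^Fin 4]→L[ℝ] ℂ) :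
    opQ γ = opT (opT (opT γ)) - (4 : ℂ) • opT (opT γ) + (16 : ℂ) • opT γ - (64 : ℂ) • γ := by
  simp [opQ]

/-- `T⁴ = 256` on `4`-forms, hence `(T + 4) ∘ Q = T⁴ - 256 = 0`: `Q` maps into the `-4`-eigenspace.
[cite: Voisin2002KaehlerCounterexample, §3 pp. 5–6] -/
private theorem opT_opQ (γ : (Fin 4 → ℂ) [⋀^Fin 4]→L[ℝ] ℂ) : opT (opQ γ) = (-4 : ℂ) • opQ γ := by
  have h4 : opT (opT (opT (opT γ))) = (256 : ℂ) • γ := by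
    simp only [opT_apply]
    exact compContinuousLinearMap_S_four γ
  rw [opQ_apply, map_sub, map_add, map_sub, map_smul, map_smul, map_smul, h4]
  module

/-- `Q Ω = -256 Ω` (`T Ω = -4 Ω`). [cite: Voisin2002KaehlerCounterexample, §3 pp. 5–6] -/
private theorem opQ_Omega : opQ Omega = (-256 : ℂ) • Omega := by
  have hT : opT Omega = (-4 : ℂ) • Omega := by rw [opT_apply]; exact Omega_compContinuousLinearMap_S
  rw [opQ_apply, hT, map_smul, hT, map_smul, map_smul, hT]
  module

/-- `Q` preserves the rational forms. [cite: Voisin2002KaehlerCounterexample, §3 pp. 5–6] -/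
private theorem opQ_mem_rationalForms {γ : (Fin 4 → ℂ) [⋀^Fin 4]→L[ℝ] ℂ}
    (hγ : γ ∈ rationalForms periodEquiv 4) : opQ γ ∈ rationalForms periodEquiv 4 := by
  have hT : ∀ δ ∈ rationalForms periodEquiv 4, opT δ ∈ rationalForms periodEquiv 4 :=
    fun δ hδ ↦ by rw [opT_apply]; exact compContinuousLinearMap_S_mem_rationalForms hδ
  have h1 := hT γ hγ
  have h2 := hT _ h1
  have h3 := hT _ h2
  rw [opQ_apply]
  have e4 : (4 : ℂ) • opT (opT γ) = (4 : ℚ) • opT (opT γ) := by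
    rw [← Rat.cast_smul_eq_qsmul ℂ (4 : ℚ)]; norm_num
  have e16 : (16 : ℂ) • opT γ = (16 : ℚ) • opT γ := by
    rw [← Rat.cast_smul_eq_qsmul ℂ (16 : ℚ)]; norm_num
  have e64 : (64 : ℂ) • γ = (64 : ℚ) • γ := by
    rw [← Rat.cast_smul_eq_qsmul ℂ (64 : ℚ)]; norm_num
  rw [e4, e16, e64]
  exact Submodule.sub_mem _ (Submodule.add_mem _ (Submodule.sub_mem _ h3
    (Submodule.smul_mem _ _ h2)) (Submodule.smul_mem _ _ h1)) (Submodule.smul_mem _ _ hγ)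

/-- **The explicit Weil torus has a non-zero Hodge class of codimension `2`**: a non-zero RATIONAL
invariant `4`-form of type `(2,2)` (a Weil class — an eigenclass of `(1 + I)^*` for the eigenvalue
`-4`; Voisin 2002 §3: "`⋀⁴_K Γ_ℚ` is made of Hodge classes"). [cite: Voisin2002KaehlerCounterexample, §3 pp. 5–6] -/
theorem exists_mem_hodgeClasses_two_ne_zero :
    ∃ γ ∈ hodgeClasses periodEquiv 2, γ ≠ 0 := by
  -- some rational form is not killed by `Q` (rational forms span `Alt⁴` over `ℂ`, `Q Ω ≠ 0`)
  have hex : ∃ γ₀ ∈ rationalForms periodEquiv 4, opQ γ₀ ≠ 0 := by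
    by_contra h
    push Not at h
    have hle : Submodule.span ℂ (rationalForms periodEquiv 4 : Set ((Fin 4 → ℂ) [⋀^Fin 4]→L[ℝ] ℂ))
        ≤ LinearMap.ker opQ := Submodule.span_le.2 fun γ hγ ↦ LinearMap.mem_ker.2 (h γ hγ)
    rw [span_complex_rationalForms_eq_top] at hle
    have hΩ : opQ Omega = 0 := LinearMap.mem_ker.1 (hle Submodule.mem_top)
    rw [opQ_Omega] at hΩ
    exact Omega_ne_zero ((smul_eq_zero.1 hΩ).resolve_left (by norm_num))
  obtain ⟨γ₀, hγ₀, hQ⟩ := hex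
  refine ⟨opQ γ₀, (mem_hodgeClasses_iff periodEquiv).2 ⟨opQ_mem_rationalForms hγ₀, ?_⟩, hQ⟩
  -- type `(2,2)`: `Q γ₀` is a `-4`-eigenform of `T`
  have hT : (opQ γ₀).compContinuousLinearMap (S.restrictScalars ℝ) = (-4 : ℂ) • opQ γ₀ := by
    rw [← opT_apply]; exact opT_opQ γ₀
  exact (isConstOfType_iff_isOfTypeAt _).1 (isConstOfType_two_two_of_compContinuousLinearMap_S _ hT)

/-- **`H⁴_Hodge(X) ≠ 0`** for the explicit Weil torus. [cite: Voisin2002KaehlerCounterexample, §3 Prop. 3] -/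
theorem hodgeClasses_two_ne_bot : hodgeClasses periodEquiv 2 ≠ ⊥ := by
  obtain ⟨γ, hγ, hne⟩ := exists_mem_hodgeClasses_two_ne_zero
  intro h
  rw [h, Submodule.mem_bot] at hγ
  exact hne hγ

/-- **Exceptional Hodge classes: `H⁴_Hodge(X) ≠ D²(X)` on the explicit complex torus of Weil type**
— its Hodge classes of codimension `2` are NOT rational combinations of products of divisor classes
(`D² = 0 ≠ H⁴_Hodge`). A concrete instance where Lange's sufficient criterion `Dᵖ = H^{2p}_Hodge`
(§7.3.1) fails, as for abelian varieties of Weil type (Lange 2023, §7.3.3 Exercise (9); Mumford–Weil)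
and for Zucker's / Voisin's non-algebraic tori (Voisin 2002, §3).
[cite: Voisin2002KaehlerCounterexample, §3 Prop. 3] [cite: Lange2023AbelianVarietiesComplex, §7.3.3 Exercise (9)] -/
theorem hodgeClasses_two_ne_divisorClasses_two :
    hodgeClasses periodEquiv 2 ≠ divisorClasses periodEquiv 2 := by
  rw [divisorClasses_two_eq_bot]
  exact hodgeClasses_two_ne_bot

/-! ### The space of Weil–Hodge classes: a `ℚ²` inside `H⁴_Hodge(X)` (Lange 2023, §7.2.4 Exercises
(9)–(10); Voisin 2002, §3) -/

/-- **The conjugate Weil form `Ω̄ = dz̄₀ ∧ dz̄₁ ∧ dz₂ ∧ dz₃`** (pointwise complex conjugate of `Ω`; a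
generator of `⋀⁴ V_{-i}^*`, Voisin 2002 §3). [cite: Voisin2002KaehlerCounterexample, §3 pp. 5–6] -/
def OmegaBar : (Fin 4 → ℂ) [⋀^Fin 4]→L[ℝ] ℂ :=
  (Complex.conjCLE.toContinuousLinearMap).compContinuousAlternatingMap Omega

/-- `Ω̄(v) = conj (Ω(v))`. [cite: Voisin2002KaehlerCounterexample, §3 pp. 5–6] -/
@[simp] theorem OmegaBar_apply (v : Fin 4 → (Fin 4 → ℂ)) : OmegaBar v = conj (Omega v) := rfl

/-- `T Ω̄ = -4 Ω̄`: `Ω̄` is a `-4`-eigenform of `(1 + J)^*` (conjugate of `T Ω = -4 Ω`).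
[cite: Voisin2002KaehlerCounterexample, §3 pp. 5–6] -/
theorem OmegaBar_compContinuousLinearMap_S :
    OmegaBar.compContinuousLinearMap (S.restrictScalars ℝ) = (-4 : ℂ) • OmegaBar := by
  ext v
  rw [ContinuousAlternatingMap.compContinuousLinearMap_apply, ContinuousAlternatingMap.smul_apply,
    OmegaBar_apply, OmegaBar_apply, smul_eq_mul]
  have h := Omega_S v
  have e : (fun i ↦ S (v i)) = (⇑(S.restrictScalars ℝ) ∘ v) := rfl
  rw [← e, h, map_mul, map_neg, map_ofNat]

/-- **The `-4`-eigenspace of `T = (1 + J)^*` on `H⁴(X, ℂ) = Alt⁴_ℝ(ℂ⁴; ℂ)`** — the complexified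
Weil–Hodge classes `⋀⁴ V_i^* ⊕ ⋀⁴ V_{-i}^*` (Voisin 2002 §3: the classes on which `1 + I` acts by
`(1 ± i)⁴ = -4`). [cite: Voisin2002KaehlerCounterexample, §3 pp. 5–6] -/
def weilEigenspace : Submodule ℂ ((Fin 4 → ℂ) [⋀^Fin 4]→L[ℝ] ℂ) :=
  LinearMap.ker (opT + (4 : ℂ) • LinearMap.id)

/-- Membership in the eigenspace: `γ ∘ S = -4 γ`. [cite: Voisin2002KaehlerCounterexample, §3 pp. 5–6] -/
theorem mem_weilEigenspace_iff (γ : (Fin 4 → ℂ) [⋀^Fin 4]→L[ℝ] ℂ) :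
    γ ∈ weilEigenspace ↔ γ.compContinuousLinearMap (S.restrictScalars ℝ) = (-4 : ℂ) • γ := by
  rw [weilEigenspace, LinearMap.mem_ker, LinearMap.add_apply, LinearMap.smul_apply, LinearMap.id_apply,
    opT_apply, add_eq_zero_iff_eq_neg, ← neg_smul]

/-- **The Weil–Hodge classes of the explicit Weil torus** `X = ℂ⁴/Φ(ℤ⁸)`, `Φ = Weil.periodEquiv`
(`K = ℚ(i)` acting through `J`): the RATIONAL classes `γ ∈ H⁴(X, ℚ)` on which the endomorphism
`1 + I` acts by `-4 = (1 ± i)⁴` — the rational points of `⋀⁴ V_i^* ⊕ ⋀⁴ V_{-i}^*`, i.e. the image of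
Lange's canonical embedding `⋀^{2n}_K H¹(X, ℚ) ↪ H^{2n}(X, ℚ)`, `n = 2` ("The cycles in the image of
this map are called Weil–Hodge cycles"; Voisin 2002 §3: "`⋀⁴_K Γ_ℚ`"). [cite: Lange2023AbelianVarietiesComplex, §7.2.4 Exercise (9)]
[cite: Voisin2002KaehlerCounterexample, §3 pp. 5–6] -/
def weilHodgeClasses : Submodule ℚ ((Fin 4 → ℂ) [⋀^Fin 4]→L[ℝ] ℂ) :=
  rationalForms periodEquiv 4 ⊓ weilEigenspace.restrictScalars ℚ

/-- Membership: rational and `γ ∘ S = -4 γ`. [cite: Lange2023AbelianVarietiesComplex, §7.2.4 Exercise (9)] -/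
theorem mem_weilHodgeClasses_iff (γ : (Fin 4 → ℂ) [⋀^Fin 4]→L[ℝ] ℂ) :
    γ ∈ weilHodgeClasses ↔ γ ∈ rationalForms periodEquiv 4 ∧
      γ.compContinuousLinearMap (S.restrictScalars ℝ) = (-4 : ℂ) • γ := by
  rw [weilHodgeClasses, Submodule.mem_inf, Submodule.restrictScalars_mem, mem_weilEigenspace_iff]

/-- Weil–Hodge classes are rational classes. [cite: Lange2023AbelianVarietiesComplex, §7.2.4 Exercise (9)] -/
theorem weilHodgeClasses_le_rationalForms : weilHodgeClasses ≤ rationalForms periodEquiv 4 :=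
  inf_le_left

/-- **Weil–Hodge classes are Hodge classes**: `⋀⁴_K H¹(X, ℚ) ↪ H⁴_Hodge(X)` — a rational
`-4`-eigenform of `(1 + J)^*` is of type `(2, 2)` (tree `isConstOfType_two_two_of_compContinuousLinearMap_S`).
[cite: Lange2023AbelianVarietiesComplex, §7.2.4 Exercise (9)] [cite: Voisin2002KaehlerCounterexample, §3 pp. 5–6] -/
theorem weilHodgeClasses_le_hodgeClasses : weilHodgeClasses ≤ hodgeClasses periodEquiv 2 := by
  intro γ hγ
  obtain ⟨hrat, hT⟩ := (mem_weilHodgeClasses_iff γ).1 hγ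
  exact (mem_hodgeClasses_iff periodEquiv).2
    ⟨hrat, (isConstOfType_iff_isOfTypeAt _).1 (isConstOfType_two_two_of_compContinuousLinearMap_S _ hT)⟩

/-- `Q = (T - 4)(T² + 16)` maps `H⁴(X, ℚ)` into the Weil–Hodge classes.
[cite: Voisin2002KaehlerCounterexample, §3 pp. 5–6] -/
private theorem opQ_mem_weilHodgeClasses {γ : (Fin 4 → ℂ) [⋀^Fin 4]→L[ℝ] ℂ}
    (hγ : γ ∈ rationalForms periodEquiv 4) : opQ γ ∈ weilHodgeClasses := by
  refine (mem_weilHodgeClasses_iff _).2 ⟨opQ_mem_rationalForms hγ, ?_⟩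
  rw [← opT_apply]
  exact opT_opQ γ

/-- `Q Ω̄ = -256 Ω̄`. [cite: Voisin2002KaehlerCounterexample, §3 pp. 5–6] -/
private theorem opQ_OmegaBar : opQ OmegaBar = (-256 : ℂ) • OmegaBar := by
  have hT : opT OmegaBar = (-4 : ℂ) • OmegaBar := by
    rw [opT_apply]; exact OmegaBar_compContinuousLinearMap_S
  rw [opQ_apply, hT, map_smul, hT, map_smul, map_smul, hT]
  module

/-- The `-4`-eigenspace is spanned by `Ω` and `Ω̄`: `ker(T + 4) ≤ span_ℂ(Ω, Ω̄)` (tree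
`Weil.exists_eq_Omega_of_apply_S`: `γ = a Ω + b Ω̄`). [cite: Voisin2002KaehlerCounterexample, §3 pp. 5–6] -/
theorem weilEigenspace_le_span :
    weilEigenspace ≤ Submodule.span ℂ (Set.range ![Omega, OmegaBar]) := by
  intro γ hγ
  rw [mem_weilEigenspace_iff] at hγ
  have hγ' : ∀ v, γ (fun i ↦ S (v i)) = -4 * γ v := fun v ↦ by
    have h := congr_fun (congrArg DFunLike.coe hγ) v
    rw [ContinuousAlternatingMap.compContinuousLinearMap_apply, ContinuousAlternatingMap.smul_apply,
      smul_eq_mul] at h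
    exact h
  obtain ⟨a, b, hab⟩ := exists_eq_Omega_of_apply_S γ hγ'
  have hγeq : γ = a • Omega + b • OmegaBar := by
    ext v
    rw [ContinuousAlternatingMap.add_apply, ContinuousAlternatingMap.smul_apply,
      ContinuousAlternatingMap.smul_apply, OmegaBar_apply, smul_eq_mul, smul_eq_mul, hab v]
  rw [hγeq]
  refine Submodule.add_mem _ (Submodule.smul_mem _ _ (Submodule.subset_span ⟨0, rfl⟩))
    (Submodule.smul_mem _ _ (Submodule.subset_span ⟨1, rfl⟩))

/-- `Ω` and `Ω̄` are linearly independent over `ℂ` (test vectors: the standard frame, where both are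
`1`, and the frame with `e₀` replaced by `J e₀ = i e₀`, where they are `i` and `-i`).
[cite: Voisin2002KaehlerCounterexample, §3 pp. 5–6] -/
theorem linearIndependent_Omega_OmegaBar : LinearIndependent ℂ ![Omega, OmegaBar] := by
  rw [LinearIndependent.pair_iff]
  intro s t hst
  set v₁ : Fin 4 → (Fin 4 → ℂ) := fun a ↦ Pi.single a 1 with hv₁
  have h1 : Omega v₁ = 1 := Omega_basis
  have h2 : Omega (Function.update v₁ 0 (J (v₁ 0))) = Complex.I := by
    rw [Omega_slotEigen, h1, mul_one]
  have e1 := congr_fun (congrArg DFunLike.coe hst) v₁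
  have e2 := congr_fun (congrArg DFunLike.coe hst) (Function.update v₁ 0 (J (v₁ 0)))
  simp only [ContinuousAlternatingMap.add_apply, ContinuousAlternatingMap.smul_apply, OmegaBar_apply,
    smul_eq_mul, ContinuousAlternatingMap.coe_zero, Pi.zero_apply, h1, h2, map_one, Complex.conj_I,
    mul_one, mul_neg] at e1 e2
  have e3 : (s - t) * Complex.I = 0 := by linear_combination e2
  have hst' : s - t = 0 := by
    rcases mul_eq_zero.1 e3 with h | h
    · exact h
    · exact absurd h Complex.I_ne_zero
  constructor
  · linear_combination (e1 + hst') / 2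
  · linear_combination (e1 - hst') / 2

/-- **The complex span of the Weil–Hodge classes is `span_ℂ(Ω, Ω̄) = ⋀⁴ V_i^* ⊕ ⋀⁴ V_{-i}^*`**
(Voisin 2002 §3: the Weil classes `⋀⁴_K Γ_ℚ` complexify to `⋀⁴ ℂ⁴_i ⊕ ⋀⁴ ℂ⁴_{-i}`): `≤` because every
Weil–Hodge class is a `-4`-eigenform; `≥` because `Q = (T - 4)(T² + 16)` maps `H⁴(X, ℚ)` into the
Weil–Hodge classes, `H⁴(X, ℚ)` spans `H⁴(X, ℂ)`, and `Q Ω = -256 Ω`, `Q Ω̄ = -256 Ω̄`.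
[cite: Voisin2002KaehlerCounterexample, §3 pp. 5–6] -/
theorem span_complex_weilHodgeClasses :
    Submodule.span ℂ (weilHodgeClasses : Set ((Fin 4 → ℂ) [⋀^Fin 4]→L[ℝ] ℂ)) =
      Submodule.span ℂ (Set.range ![Omega, OmegaBar]) := by
  refine le_antisymm (Submodule.span_le.2 fun γ hγ ↦ ?_) (Submodule.span_le.2 ?_)
  · exact weilEigenspace_le_span ((Submodule.restrictScalars_mem ℚ _ _).1
      (Submodule.mem_inf.1 (show γ ∈ weilHodgeClasses from hγ)).2)
  · -- `Q(H⁴(X, ℂ)) ⊆ span_ℂ(Weil–Hodge classes)` (true on `H⁴(X, ℚ)`, which spans), and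
    -- `Ω = -Q Ω/256`, `Ω̄ = -Q Ω̄/256`
    set U := Submodule.span ℂ (weilHodgeClasses : Set ((Fin 4 → ℂ) [⋀^Fin 4]→L[ℝ] ℂ)) with hU
    have hQ : ∀ δ : (Fin 4 → ℂ) [⋀^Fin 4]→L[ℝ] ℂ, opQ δ ∈ U := by
      have hle : Submodule.span ℂ (rationalForms periodEquiv 4 : Set ((Fin 4 → ℂ) [⋀^Fin 4]→L[ℝ] ℂ))
          ≤ U.comap opQ :=
        Submodule.span_le.2 fun γ hγ ↦ Submodule.subset_span (opQ_mem_weilHodgeClasses hγ)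
      rw [span_complex_rationalForms_eq_top] at hle
      exact fun δ ↦ hle Submodule.mem_top
    have hΩ : Omega ∈ U := by
      have h : Omega = (-256 : ℂ)⁻¹ • opQ Omega := by rw [opQ_Omega, smul_smul]; norm_num
      rw [h]; exact U.smul_mem _ (hQ _)
    have hΩ' : OmegaBar ∈ U := by
      have h : OmegaBar = (-256 : ℂ)⁻¹ • opQ OmegaBar := by rw [opQ_OmegaBar, smul_smul]; norm_num
      rw [h]; exact U.smul_mem _ (hQ _)
    rintro _ ⟨i, rfl⟩
    fin_cases i
    · exact hΩ
    · exact hΩ'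

/-- **`dim_ℚ (Weil–Hodge classes) = 2`** on the explicit Weil torus — Lange §7.2.4 Exercise (10):
"`H^{2n}_Hodge(X) = ℚ³`, the direct sum of `D^n(X)` (`= ℚ`) and the space of Weil–Hodge cycles" for a
general polarised abelian variety of Weil type, i.e. the Weil–Hodge cycles `⋀^{2n}_K H¹(X, ℚ)` form a
`ℚ`-plane (`[K : ℚ] · dim_K ⋀^{2n}_K K^{2n} = 2`); here `n = 2`, computed as
`dim_ℚ = dim_ℂ span_ℂ = dim_ℂ span(Ω, Ω̄) = 2`. [cite: Lange2023AbelianVarietiesComplex, §7.2.4 Exercises (9)–(10)]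
[cite: Voisin2002KaehlerCounterexample, §3 pp. 5–6] -/
theorem finrank_weilHodgeClasses : finrank ℚ weilHodgeClasses = 2 := by
  rw [← finrank_span_complex_eq periodEquiv weilHodgeClasses_le_rationalForms,
    span_complex_weilHodgeClasses, finrank_span_eq_card linearIndependent_Omega_OmegaBar,
    Fintype.card_fin]

/-- The Weil–Hodge classes are a non-zero space (they contain the class `Q γ₀ ≠ 0` of
`exists_mem_hodgeClasses_two_ne_zero`). [cite: Lange2023AbelianVarietiesComplex, §7.2.4 Exercise (9)] -/
theorem weilHodgeClasses_ne_bot : weilHodgeClasses ≠ ⊥ := fun h ↦ by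
  have h2 := finrank_weilHodgeClasses
  rw [h, finrank_bot] at h2
  exact absurd h2 (by norm_num)

/-- **`dim_ℚ H⁴_Hodge(X) ≥ 2`** for the explicit Weil torus (it contains the Weil–Hodge plane).
[cite: Lange2023AbelianVarietiesComplex, §7.2.4 Exercises (9)–(10)] -/
theorem two_le_finrank_hodgeClasses_two : 2 ≤ finrank ℚ (hodgeClasses periodEquiv 2) := by
  haveI : FiniteDimensional ℚ (hodgeClasses periodEquiv 2) := finiteDimensional_hodgeClassesIn periodEquiv _ _
  have h := Submodule.finrank_mono weilHodgeClasses_le_hodgeClasses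
  rw [finrank_weilHodgeClasses] at h
  exact h

/-- **No Weil–Hodge class of this torus is a divisor-generated class**: `W ∩ D² = 0` (indeed
`D²(X) = 0`, `divisorClasses_two_eq_bot`) — Lange §7.2.4 Exercise (10): `H^{2n}_Hodge` is the DIRECT
sum of `D^n` and the Weil–Hodge cycles. [cite: Lange2023AbelianVarietiesComplex, §7.2.4 Exercise (10)] -/
theorem weilHodgeClasses_inf_divisorClasses_eq_bot :
    weilHodgeClasses ⊓ divisorClasses periodEquiv 2 = ⊥ := by
  rw [divisorClasses_two_eq_bot, inf_bot_eq]

end Weil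

end Literature.Geometry.Kaehler

end
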